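import Summits.QuantumFields.QCD.Theses.NestedDissectionSea
import Literature.Barriers.QuantumFields.WilsonDeterminantMassSplitting

/-!
# Sketch — crux-ideate `SeaFactorisationBridge` (stmt-QuantumFields-13880), round 1, ideator 3,
# generation 2: first lemmas of the crux idea card `cofactor-valence`

The card's lever is the exact COFACTOR (Grassmann-minor) form of every fermionic lattice-QCD
correlator: `(∏_f det D_f) × ⟨quark polynomial⟩_F` is a minor of the Wilson–Dirac matrix, an entire
bounded polynomial in the links, and `γ₅`-Hermiticity passes to the adjugate, so the
flavour-changing pseudoscalar numerator of a degenerate pair is a squared Frobenius norm of a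
cofactor block — non-negative configuration by configuration, with no inverse and no
"exceptional configuration" anywhere.

Proved here (exact part, E1–E3):
* `adjugate_of_mul_self_eq_one`, `det_mul_det_of_mul_self_eq_one` — adjugate of an involution;
* `isGammaHermitian_adjugate` — `Γ D Γ = Dᴴ`, `Γ² = 1` ⇒ the same for `adjugate D`;
* `gammaTrace_eq_frobenius` — for `Γ = diagonal d`, `d² = 1`, `Γ`-Hermitian `A` and any two index
  blocks `S, T`: `tr[A_{ST} Γ_T A_{TS} Γ_S] = ‖A_{ST}‖_F²` (the pion kernel identity; apply it to
  `A = adjugate (wilsonDirac ρ U μ 1)`, `Γ = spinorLift γ₅`, `S, T` = the 12 indices at sites `x, y`).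
Statements that elaborate (the line's next lemmas / first stub): `BerezinSourcePair` (Wick, one
pair = cofactor), `CofactorChannelDomination` (Weingarten domination at cofactor level),
`LyapunovLowerBound` (RP log-convexity: non-triviality is a short-distance statement),
`DoubletPionCofactorDecay` (THE first genuine stub of the line: the two-defect free energy of the
doublet sea grows linearly in Euclidean time), `ChildrenBlockInverse` (F5: propagation between children
passes through `S_Σ⁻¹`), `SeparatorCompression` (F6: `S_Σ⁻¹ = (M⁻¹)_ΣΣ`); `lyapunovLowerBound_holds`
proves F3.
-/

noncomputable section

namespace Summit.QuantumFields.QCD.Cruxes.SeaFactorisationBridge.Ideator3G2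

open Matrix Complex Filter Topology MeasureTheory
open scoped BigOperators ComplexOrder
open Literature.MathematicalPhysics.QuantumLattice Literature.MathematicalPhysics.QuantumFieldTheory
open Literature.Probability.LatticeModels
open Literature.Barriers.QuantumFields.WilsonSign

/-- Local notation: the colour group `SU(3)`. -/
local notation "SU3" => Matrix.specialUnitaryGroup (Fin 3) ℂ

/-! ## E1–E3: the exact part (cofactor algebra) -/

section Algebra

variable {n : Type*} [Fintype n] [DecidableEq n]

/-- **E1.** The adjugate of an involution `Γ` (`Γ² = 1`) is `det Γ • Γ`. -/
theorem adjugate_of_mul_self_eq_one {Γ : Matrix n n ℂ} (h : Γ * Γ = 1) :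
    adjugate Γ = Γ.det • Γ := by
  calc adjugate Γ = Γ * Γ * adjugate Γ := by rw [h, Matrix.one_mul]
    _ = Γ * (Γ * adjugate Γ) := Matrix.mul_assoc _ _ _
    _ = Γ * (Γ.det • (1 : Matrix n n ℂ)) := by rw [mul_adjugate]
    _ = Γ.det • Γ := by rw [Matrix.mul_smul, Matrix.mul_one]

/-- **E1'.** `det Γ · det Γ = 1` for an involution. -/
theorem det_mul_det_of_mul_self_eq_one {Γ : Matrix n n ℂ} (h : Γ * Γ = 1) :
    Γ.det * Γ.det = 1 := by
  rw [← det_mul, h, det_one]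

/-- **E2 (`γ₅`-Hermiticity of the cofactor matrix).** If `Γ D Γ = Dᴴ` with `Γ² = 1` then the same
holds for `adjugate D` — for EVERY matrix `D`, invertible or not: no determinant in a denominator,
no exceptional configuration.  (`adjugate Dᴴ = (adjugate D)ᴴ`, `adjugate (ΓDΓ) = adj Γ · adj D · adj Γ`,
`adj Γ = det Γ • Γ`, `(det Γ)² = 1`.) -/
theorem isGammaHermitian_adjugate {Γ D : Matrix n n ℂ} (h : IsGammaHermitian Γ D) :
    IsGammaHermitian Γ (adjugate D) where
  conj_eq := by
    rw [adjugate_conjTranspose, ← h.conj_eq, adjugate_mul_distrib, adjugate_mul_distrib,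
      adjugate_of_mul_self_eq_one h.sq_eq_one, Matrix.smul_mul, Matrix.mul_smul, Matrix.mul_smul,
      smul_smul, det_mul_det_of_mul_self_eq_one h.sq_eq_one, one_smul, Matrix.mul_assoc]
  sq_eq_one := h.sq_eq_one

/-- **E3 (the pion-kernel identity at the cofactor level).** For a DIAGONAL involution
`Γ = diagonal d`, `d i · d i = 1` (the tree's `spinorLift γ₅`, `γ₅ = diag(1,1,−1,−1)`), a
`Γ`-Hermitian matrix `A` (e.g. `A = adjugate (wilsonDirac ρ U μ 1)` by E2, or the propagator when it
exists) and ANY two index blocks `S, T` (the 12 spin–colour indices at the sites `x` and `y`):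
`∑_{p,p' ∈ S} ∑_{q,q' ∈ T} A_{p'q} Γ_{qq'} A_{q'p} Γ_{pp'} = ∑_{p ∈ S, q ∈ T} A_{pq} · conj(A_{pq})`, i.e.
`tr[A(x,y) γ₅ A(y,x) γ₅] = ‖A(x,y)‖_F² ≥ 0`: the flavour-changing pseudoscalar two-point NUMERATOR of
a mass-degenerate pair is a squared Frobenius norm of a cofactor block, configuration by
configuration (Weingarten's positivity, with `det² · ‖S‖²` replaced by `‖adj‖²`). -/
theorem gammaTrace_eq_frobenius {Γ A : Matrix n n ℂ} (h : IsGammaHermitian Γ A) {d : n → ℂ}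
    (hΓ : Γ = diagonal d) (hd : ∀ i, d i * d i = 1) (S T : Finset n) :
    (∑ p ∈ S, ∑ q ∈ T, ∑ p' ∈ S, ∑ q' ∈ T, A p' q * Γ q q' * A q' p * Γ p p') =
      ∑ p ∈ S, ∑ q ∈ T, A p q * star (A p q) := by
  subst hΓ
  have hAeq : A = diagonal d * Aᴴ * diagonal d := by
    calc A = diagonal d * diagonal d * A * (diagonal d * diagonal d) := by
          rw [h.sq_eq_one, Matrix.one_mul, Matrix.mul_one]
      _ = diagonal d * (diagonal d * A * diagonal d) * diagonal d := by
          simp only [Matrix.mul_assoc]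
      _ = diagonal d * Aᴴ * diagonal d := by rw [h.conj_eq]
  have hA : ∀ i j, A i j = d i * star (A j i) * d j := by
    intro i j
    conv_lhs => rw [hAeq]
    rw [mul_diagonal, diagonal_mul, conjTranspose_apply]
  have key : ∀ p ∈ S, ∀ q ∈ T,
      (∑ p' ∈ S, ∑ q' ∈ T, A p' q * diagonal d q q' * A q' p * diagonal d p p') =
        A p q * star (A p q) := by
    intro p hp q hq
    have hsum : ∀ p' ∈ S, (∑ q' ∈ T, A p' q * diagonal d q q' * A q' p * diagonal d p p') =
        if p = p' then A p q * d q * A q p * d p else 0 := by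
      intro p' _
      have hterm : ∀ q', A p' q * diagonal d q q' * A q' p * diagonal d p p' =
          if q = q' then (if p = p' then A p' q * d q * A q' p * d p else 0) else 0 := by
        intro q'
        simp only [diagonal_apply]
        split_ifs <;> simp
      rw [Finset.sum_congr rfl (fun q' _ => hterm q'), Finset.sum_ite_eq, if_pos hq]
      split_ifs with hpp
      · subst hpp; rfl
      · rfl
    rw [Finset.sum_congr rfl hsum, Finset.sum_ite_eq, if_pos hp, hA q p]
    have e1 : A p q * d q * (d q * star (A p q) * d p) * d p =
        A p q * star (A p q) * (d q * d q) * (d p * d p) := by ring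
    rw [e1, hd q, hd p, mul_one, mul_one]
  exact Finset.sum_congr rfl (fun p hp => Finset.sum_congr rfl (fun q hq => key p hp q hq))

/-- **E2 for the tree's operator**: the cofactor matrix of `D_W(U, μ) = wilsonDirac ρ U μ 1` is
`γ₅`-Hermitian for every unitary `ρ`, gauge field and bare mass (feeds E3 with
`Γ = spinorLift γ₅ = diagonal`, `spinorLift_gammaFive_eq_diagonal`). -/
theorem isGammaHermitian_adjugate_wilsonDirac {L N : ℕ} [NeZero L] {G : Type*} [Group G]
    (ρ : G →* Matrix (Fin N) (Fin N) ℂ) (hρ : ∀ g, ρ g ∈ Matrix.unitaryGroup (Fin N) ℂ)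
    (U : GaugeConfig 4 L G) (μ : ℝ) :
    IsGammaHermitian (spinorLift gammaFive) (adjugate (wilsonDirac ρ U μ 1)) :=
  isGammaHermitian_adjugate (Literature.Barriers.QuantumFields.isGammaHermitian_wilsonDirac ρ hρ U μ 1)

end Algebra

/-! ## Statements (elaborate; the line's next lemmas and first stub) -/

/-- **F1 (Wick's theorem, one pair = one cofactor; provable, size M, extends the landed Gaussian
case `berezin_grassmannExp_quadratic_holds`).** Up to one universal orientation sign,
`∫ dψ̄ dψ  ψ_j ψ̄_i e^{ψ̄Aψ} = ± (adj A)_{ji}` for EVERY matrix `A` (no invertibility): the source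
pair digs one row and one column out of the determinant.  Iterated (Jacobi's complementary-minor
theorem) it says: `(∏_f det D_f) ×` any fermionic correlator is a MINOR of the flavour-diagonal
Dirac matrix — a polynomial in the link entries, bounded on `SU(3)^E` by a Hadamard constant. -/
def BerezinSourcePair : Prop :=
  ∀ (ι : Type) [Fintype ι] [DecidableEq ι] [LinearOrder ι],
    ∃ ε : ℂ, ε ^ 2 = 1 ∧ ∀ (A : Matrix ι ι ℂ) (i j : ι),
      GrassmannAlgebra.berezin ℂ (ι ⊕ₗ ι) (psi ℂ j * psiBar ℂ i * grassmannExp (quadratic ℂ A)) =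
        ε * A.adjugate j i

/-- **F2 (Weingarten domination at the cofactor level; provable now, Cauchy–Schwarz, size S–M).**
Every flavoured meson kernel `tr[A(x,y) Γ₁ B(y,x) Γ₂]` built from two (cofactor or propagator)
matrices and bounded spin matrices is dominated by the geometric mean of the two pion kernels
`‖A(x,y)‖_F ‖B(y,x)‖_F` (crude constants).  With E3 this reduces the whole flavour-non-singlet part
of `HasLatticeMassGap` to ONE kernel per mass pair. -/
def CofactorChannelDomination : Prop :=
  ∀ (n : Type) [Fintype n] [DecidableEq n] (A B G₁ G₂ : Matrix n n ℂ) (S T : Finset n) (c₁ c₂ : ℝ),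
    (∀ i j, ‖G₁ i j‖ ≤ c₁) → (∀ i j, ‖G₂ i j‖ ≤ c₂) →
      ‖∑ p ∈ S, ∑ q ∈ T, ∑ p' ∈ S, ∑ q' ∈ T, A p' q * G₁ q q' * B q' p * G₂ p p'‖ ≤
        c₁ * c₂ * (T.card * S.card : ℝ) *
          Real.sqrt (∑ p ∈ S, ∑ q ∈ T, ‖A p q‖ ^ 2) * Real.sqrt (∑ p ∈ S, ∑ q ∈ T, ‖B q p‖ ^ 2)

/-- **F3 (non-triviality is a short-distance statement; provable now from Jensen / Lyapunov,
Mathlib `ConvexOn.map_integral_le`).** For a reflection-positive two-point function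
`C(t) = ∫ e^{−Et} dρ(E)` (`ρ` a probability law on energies — the Källén–Lehmann / transfer-matrix
form of the pseudoscalar correlator of the RP lattice theory), a lower bound at ONE short time
`t₀` propagates to all later times: `C(t) ≥ C(t₀)^{t/t₀}`.  So `T.IsNontrivial (pseudoRe f g)`
needs only a `k`-uniform lower bound on the smeared pion correlator at one pair of SHORT positive
times — the asymptotically free regime of the valence sector — never a meson-spectroscopy bound. -/
def LyapunovLowerBound : Prop :=
  ∀ (ρ : Measure ℝ) [IsProbabilityMeasure ρ] (t₀ t : ℝ), 0 < t₀ → t₀ ≤ t →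
    Integrable (fun E => Real.exp (-(E * t₀))) ρ → Integrable (fun E => Real.exp (-(E * t))) ρ →
      (∫ E, Real.exp (-(E * t₀)) ∂ρ) ^ (t / t₀) ≤ ∫ E, Real.exp (-(E * t)) ∂ρ

/-- **F3 proved** (Jensen for the convex power `x ↦ x^{t/t₀}` on `[0, ∞)`, Mathlib
`ConvexOn.map_integral_le`, `convexOn_rpow`). -/
theorem lyapunovLowerBound_holds : LyapunovLowerBound := by
  intro ρ _ t₀ t ht₀ ht hI₀ hI
  have hr : 1 ≤ t / t₀ := by rwa [le_div_iff₀ ht₀, one_mul]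
  have hcancel : t / t₀ * t₀ = t := div_mul_cancel₀ t ht₀.ne'
  have hcomp : ∀ E : ℝ, Real.exp (-(E * t₀)) ^ (t / t₀) = Real.exp (-(E * t)) := by
    intro E
    rw [← Real.exp_mul]
    congr 1
    calc -(E * t₀) * (t / t₀) = -(E * (t / t₀ * t₀)) := by ring
      _ = -(E * t) := by rw [hcancel]
  have hgi : Integrable ((fun x : ℝ => x ^ (t / t₀)) ∘ fun E => Real.exp (-(E * t₀))) ρ := by
    have : ((fun x : ℝ => x ^ (t / t₀)) ∘ fun E => Real.exp (-(E * t₀))) =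
        fun E => Real.exp (-(E * t)) := by
      funext E; exact hcomp E
    rw [this]; exact hI
  have hJ := (convexOn_rpow hr).map_integral_le
    (Real.continuous_rpow_const (by linarith)).continuousOn isClosed_Ici
    (Filter.Eventually.of_forall fun E => Set.mem_Ici.2 (Real.exp_pos _).le) hI₀ hgi
  calc (∫ E, Real.exp (-(E * t₀)) ∂ρ) ^ (t / t₀)
      ≤ ∫ E, (Real.exp (-(E * t₀))) ^ (t / t₀) ∂ρ := hJ
    _ = ∫ E, Real.exp (-(E * t)) ∂ρ := integral_congr_ae (Filter.Eventually.of_forall hcomp)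

/-- **F5 (provable now, Mathlib block inverse; size S–M): propagation between children goes
through the separator.**  For the Dirichlet cell matrix `M = wilsonCell U μ 0 s` with children
interior `I` and internal separator `Σ`: if the children block `M_II` and the Schur separator
`S_Σ` are invertible, the interior block of `M⁻¹` is `M_II⁻¹ + M_II⁻¹ M_IΣ S_Σ⁻¹ M_ΣI M_II⁻¹`; the
first term is block diagonal over the sixteen children (no hop crosses a sheet), so a valence line
(cofactor block, by F1) between points of DIFFERENT children factors as
[inside child 1 to the sheet] · `S_Σ⁻¹` along the sheet · [sheet to inside child 2] — the
lowest-common-ancestor law that turns flavoured decay into decay of `S_Σ⁻¹` along physical-size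
separators (heavy block mass: Combes–Thomas on the sheet operator; cf. `CoerciveSea` (i),
twisted ellipticity). -/
def ChildrenBlockInverse : Prop :=
  ∀ (N : ℕ) [NeZero N] (U : GaugeConfig 4 N SU3) (μ : ℝ) (s : Fin 4 → ℕ),
    let M := wilsonCell U μ 0 s
    let I : {p // wilsonBox (0 : TorusSite 4 N) s p} → Prop := childrenInterior s
    IsUnit (M.toBlock I I).det → IsUnit (schurSeparator U μ s).det →
      M⁻¹.toBlock I I =
        (M.toBlock I I)⁻¹ +
          (M.toBlock I I)⁻¹ * M.toBlock I (fun p => ¬ I p) * (schurSeparator U μ s)⁻¹ *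
            M.toBlock (fun p => ¬ I p) I * (M.toBlock I I)⁻¹

/-- **F6 (compression; provable now from the block-inverse formula, size S): a separator is never
more singular than its cell.**  Under invertibility of the children block and of the cell matrix
`M = wilsonCell U μ 0 s`, the separator block of `M⁻¹` inverts the Schur separator:
`(M⁻¹)_ΣΣ · S_Σ = 1`, i.e. `S_Σ⁻¹ = (M⁻¹)_ΣΣ` is a COMPRESSION of the cell's inverse, so
`‖S_Σ⁻¹‖ ≤ ‖M⁻¹‖` and a near-kernel vector of the cell enters `S_Σ⁻¹` only through its mass on the
sheet; in cofactor normalisation `det M · S_Σ⁻¹ = adj(M)_ΣΣ` is again an entire polynomial (the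
sheet propagator of F5 in the form the defect free energy uses). -/
def SeparatorCompression : Prop :=
  ∀ (N : ℕ) [NeZero N] (U : GaugeConfig 4 N SU3) (μ : ℝ) (s : Fin 4 → ℕ),
    let M := wilsonCell U μ 0 s
    let I : {p // wilsonBox (0 : TorusSite 4 N) s p} → Prop := childrenInterior s
    IsUnit (M.toBlock I I).det → IsUnit M.det →
      M⁻¹.toBlock (fun p => ¬ I p) (fun p => ¬ I p) * schurSeparator U μ s = 1

/-- Euclidean-time distance on the torus `ℤ/N`. -/
def timeDist {N : ℕ} (x y : TorusSite 4 N) : ℕ := min (x 0 - y 0).val (y 0 - x 0).val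

/-- **F4 — THE FIRST GENUINE STUB of the line (`DoubletPionCofactorDecay`): the two-defect free
energy of the degenerate-doublet sea grows linearly in Euclidean time.**  Along one admissible
regularisation, above a threshold, for the `N_f = 2` DEGENERATE valence/sea mass
`μ_k = m_crit(k) + a_k m/Z_m(k)`: eventually in `k`, on every torus `2S+1 ≥ 2L_k+1`, for all sites
`x, y`, the pure-Wilson expectation of the squared cofactor block
`‖adj(D_W(U, μ_k))(x, y)‖_F²` (= by E3/F1 the un-normalised flavour-changing pseudoscalar two-point
numerator, a bounded polynomial in the links) is at most `C e^{−c a_k dist₀(x,y)}` times the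
doublet partition function `∫ det(D_W(U, μ_k))² dμ_W` — i.e. the pion correlator of two-flavour
lattice QCD decays at a physical rate `c > 0`, uniformly in the volume.  Physically `c ≈ 2m`; any
`c > 0` serves the flavoured half of `HasLatticeMassGap`.  `C, c` may depend on `m` (the
conclusion's `Δ` comes after `m`). -/
def DoubletPionCofactorDecay : Prop :=
  let ρ₃ : SU3 →* Matrix (Fin 3) (Fin 3) ℂ := fundamentalRep (Fin 3)
  ∃ reg : QCDRegularisation 2, reg.HasMassScaling ∧ (reg.scheme 0 0 0).HasAsymptoticScaling ∧
    ∃ M₀ : ℝ, 0 ≤ M₀ ∧ ∀ m : ℝ, M₀ < m → ∃ C c : ℝ, 0 < c ∧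
      ∀ᶠ k : ℕ in atTop, ∀ S : ℕ, reg.L k ≤ S →
        let N : ℕ := 2 * S + 1
        let μ : ℝ := reg.mcrit k + reg.a k * m / reg.Zm k
        ∀ x y : TorusSite 4 N,
          (∫ U, ∑ a : Fin 3, ∑ α : Fin 4, ∑ b : Fin 3, ∑ β : Fin 4,
              ‖(wilsonDirac ρ₃ U μ 1).adjugate (x, a, α) (y, b, β)‖ ^ 2
              ∂(wilsonMeasure (d := 4) (L := N) ρ₃ (reg.β k))) ≤
            C * Real.exp (-(c * (reg.a k * timeDist x y))) *
              ∫ U, (((wilsonDirac ρ₃ U μ 1).det) ^ 2).re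
                ∂(wilsonMeasure (d := 4) (L := N) ρ₃ (reg.β k))

end Summit.QuantumFields.QCD.Cruxes.SeaFactorisationBridge.Ideator3G2

end
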